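import Mathlib.Geometry.Manifold.PartitionOfUnity
import Literature.Geometry.Kaehler.HolomorphicLineBundleChernConnection
import HarnessLib

/-!
# Every holomorphic line cocycle carries a Hermitian metric, and a global Chern form

Layer `Literature/Geometry/Kaehler`. For a holomorphic line bundle `L` presented by a cocycle
(`HolomorphicLineBundle`, frames `σ_i = g_ij σ_j`) on a Hausdorff σ-compact complex manifold `M`
(finite-dimensional model `E`):

* `HolomorphicLineBundle.metricOfPartition` / `exists_hermitianMetric` — **a Hermitian metric on `L`**
  (`HermitianMetric`: weights `h_i = h(σ_i) > 0`, real `C^∞` on `U_i`, `h_i = |g_ij|² h_j`), glued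
  from the flat metrics `|·|²` of the trivialisations by a smooth partition of unity `(ρ_k)`
  subordinate to the cover: `h_i = Σ_k ρ_k |g_ik|²` (Voisin (2002), §3.3.1 with the opening of Ch. 3,
  p. 63: "A complex manifold `X` can always be equipped with a Hermitian metric […] using partitions
  of unity and local trivialisations"; Kobayashi (1987), Ch. I Prop. 4.? / Wells (1980), Ch. III
  Prop. 1.6: every vector bundle over a paracompact manifold admits a Hermitian metric);
* `HolomorphicLineBundle.HermitianMetric.exists_isChernForm` — **a global Chern form**: a smooth
  closed `2`-form `θ` with `θ|_{U_i} = (1/4π) d((d log h_i) ∘ J)` (`HermitianMetric.IsChernForm`), namely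
  a first Chern character form of the Chern connection (Chern–Weil I,
  `Connection.exists_isChernCharacterForm`, read through
  `HermitianMetric.chernCharacterForm_chernConnection_one_apply`). Voisin (2002), §3.3.1: "The `2`-forms
  `ω_i` […] coincide on `U_i ∩ U_j` […] and provide a `2`-form `ω` on `X` […] called the Chern form".

Everything is proved; no named facts.

## References

* C. Voisin, *Hodge Theory and Complex Algebraic Geometry I* (2002), Ch. 3 p. 63, §3.3.1. [VoisinHodgeI2002]
* R. O. Wells, *Differential Analysis on Complex Manifolds* (1980), Ch. III Prop. 1.6. [WellsDACM1980]
-/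

noncomputable section

open scoped Manifold ContDiff Topology
open Set Filter Function

namespace Literature.Geometry.Kaehler

namespace HolomorphicLineBundle

variable {ι : Type*} {E : Type*} [NormedAddCommGroup E] [NormedSpace ℂ E] [FiniteDimensional ℂ E]
  {M : Type*} [TopologicalSpace M] [ChartedSpace E M] [IsManifold 𝓘(ℂ, E) ω M]
  [IsManifold 𝓘(ℝ, E) ∞ M]

/-- **The Hermitian metric glued from a partition of unity**: for a smooth partition of unity `ρ`
subordinate to the trivialising cover of `L`, the weights `h_i = Σ_k ρ_k |g_ik|²` (on `U_i ∩ U_j`,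
`g_ik = g_ij g_jk` wherever `ρ_k ≠ 0`, so `h_i = |g_ij|² h_j`; `h_i > 0` since some `ρ_k > 0` and then
`g_ik ≠ 0`). [cite: VoisinHodgeI2002, Ch. 3 p. 63 and §3.3.1] -/
def metricOfPartition (L : HolomorphicLineBundle ι E M) (ρ : SmoothPartitionOfUnity ι 𝓘(ℝ, E) M univ)
    (hρ : ρ.IsSubordinate L.baseSet) : L.HermitianMetric where
  weight i x := ∑ᶠ k, ρ k x * ‖L.coordChange i k x‖ ^ 2
  weight_pos i x hx := by
    obtain ⟨k, hk⟩ := ρ.exists_pos_of_mem (mem_univ x)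
    have hxk : x ∈ L.baseSet k := hρ k (subset_tsupport _ hk.ne')
    have hterm : 0 < ρ k x * ‖L.coordChange i k x‖ ^ 2 :=
      mul_pos hk (pow_pos (norm_pos_iff.2 (L.coordChange_ne_zero i k x ⟨hx, hxk⟩)) 2)
    refine hterm.trans_le (single_le_finsum (f := fun j ↦ ρ j x * ‖L.coordChange i j x‖ ^ 2) k ?_
      fun j ↦ mul_nonneg (ρ.nonneg j x) (sq_nonneg _))
    exact (ρ.locallyFinite.point_finite x).subset fun j hj ↦ by
      simpa only [mem_setOf_eq, Function.mem_support] using left_ne_zero_of_mul hj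
  contMDiffOn_weight i x hx := by
    refine (ρ.contMDiffAt_finsum (x₀ := x) (g := fun k y ↦ ‖L.coordChange i k y‖ ^ 2)
      fun k hk ↦ ?_).contMDiffWithinAt
    have hxk : x ∈ L.baseSet k := hρ k hk
    have hg : ContMDiffAt 𝓘(ℝ, E) 𝓘(ℝ, ℂ) ∞ (L.coordChange i k) x :=
      contMDiffAt_real_of_mdifferentiableOn_complex (L.mdifferentiableOn_coordChange i k)
        ((L.isOpen_baseSet i).inter (L.isOpen_baseSet k)) ⟨hx, hxk⟩
    exact ((contDiff_norm_sq ℝ (E := ℂ)).contDiffAt.comp_contMDiffAt hg)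
  weight_eq i j x hx := by
    have hterm : ∀ k, ρ k x * ‖L.coordChange i k x‖ ^ 2 =
        ‖L.coordChange i j x‖ ^ 2 * (ρ k x * ‖L.coordChange j k x‖ ^ 2) := by
      intro k
      by_cases hk : ρ k x = 0
      · rw [hk, zero_mul, zero_mul, mul_zero]
      · have hxk : x ∈ L.baseSet k := hρ k (subset_tsupport _ hk)
        rw [← L.coordChange_comp i j k x ⟨hx, hxk⟩, norm_mul, mul_pow]
        ring
    show ∑ᶠ k, ρ k x * ‖L.coordChange i k x‖ ^ 2 =
      ‖L.coordChange i j x‖ ^ 2 * ∑ᶠ k, ρ k x * ‖L.coordChange j k x‖ ^ 2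
    rw [mul_finsum]
    exact finsum_congr hterm

/-- **Every holomorphic line cocycle on a Hausdorff σ-compact complex manifold admits a Hermitian
metric** (partitions of unity). [cite: VoisinHodgeI2002, Ch. 3 p. 63 and §3.3.1] -/
theorem nonempty_hermitianMetric [T2Space M] [SigmaCompactSpace M] (L : HolomorphicLineBundle ι E M) :
    Nonempty L.HermitianMetric := by
  haveI : FiniteDimensional ℝ E := FiniteDimensional.complexToReal E
  obtain ⟨ρ, hρ⟩ := SmoothPartitionOfUnity.exists_isSubordinate (I := 𝓘(ℝ, E)) isClosed_univ L.baseSet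
    L.isOpen_baseSet fun x _ ↦ mem_iUnion.2 (L.exists_mem_baseSet x)
  exact ⟨L.metricOfPartition ρ hρ⟩

namespace HermitianMetric

variable {L : HolomorphicLineBundle ι E M} (h : L.HermitianMetric)

/-- **A Hermitian line cocycle has a global Chern form**: a smooth closed `2`-form `θ` on `M` with
`θ = (1/4π) d((d log h_i) ∘ J)` on every `U_i` (Voisin (2002), §3.3.1: the local forms `ω_i` coincide
on overlaps and "provide a `2`-form `ω` on `X` […] called the Chern form") — a first Chern character
form of the Chern connection (Chern–Weil I, `Connection.exists_isChernCharacterForm`, with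
`chernCharacterForm_chernConnection_one_apply`). [cite: VoisinHodgeI2002, §3.3.1] -/
theorem exists_isChernForm :
    ∃ θ : MForm 𝓘(ℝ, E) M ℂ 2, IsSmoothForm θ ∧ IsClosedForm θ ∧ h.IsChernForm θ := by
  obtain ⟨θ, hs, hc, hθ⟩ := h.chernConnection.exists_isChernCharacterForm 1
  exact ⟨θ, hs, hc, fun i x hx ↦ by rw [hθ i x hx, h.chernCharacterForm_chernConnection_one_apply hx]⟩

end HermitianMetric

end HolomorphicLineBundle

end Literature.Geometry.Kaehler
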